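import Literature.Geometry.Kaehler.ComplexTorusIntegralHodgeClassesRank
import Literature.GroupTheory.Abelian.PureSubgroupFreeQuotient
import Mathlib.LinearAlgebra.Basis.Prod
import HarnessLib

/-!
# `Hdg^{k,p}(X, ℤ)` is a PRIMITIVE sublattice of `Hᵏ(X, ℤ)`, hence a DIRECT SUMMAND: `Hᵏ(X, ℤ) = Hdg^{k,p}(X, ℤ) ⊕ K` with `K` free of
# rank `C(2g, k) − rk Hdg^{k,p}(X, ℤ)`; every `ℤ`-basis of `Hdg^{k,p}(X, ℤ)` extends to a `ℤ`-basis of `Hᵏ(X, ℤ)`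

Layer `Literature/Geometry/Kaehler`, namespace `Literature.Geometry.Kaehler.ComplexTorus`; lane `lit-hodgefound` (Track 2
foundations library), seat p09, generation 31, row g31-#8. THEOREMS ONLY (0 definitions); no named fact, net debt 0. For a complex
torus `X = E/Φ(ℤ^ι)` and every degree `k` and type index `p`, the lattice of integral Hodge classes `Hdg^{k,p}(X, ℤ) = Hᵏ(X, ℤ) ∩ Λ^{p,p}`
(A4-23 `integralHodgeClassesIn Φ k p`; Voisin Def. 11.28 "`Hdg(V) = V_ℤ ∩ V^{p,p}`") sits inside the lattice `Hᵏ(X, ℤ) = integralForms Φ k`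
(free of rank `C(2g, k)`, Lange Exercise 1.1.6 (8)) as the sublattice `AddSubgroup.toIntSubmodule ((integralHodgeClassesIn Φ k p).addSubgroupOf
(integralForms Φ k))` (the tree's spelling of `Hdg ⊂ H^{2p}(X, ℤ)` in g30-#4…#9, there for `k = 2p`). This file proves:

* §1 it is SATURATED ("primitive": `n · x ∈ Hdg`, `n ≠ 0` `⟹` `x ∈ Hdg`, since `Λ^{p,p}` is a `ℂ`-subspace — Huybrechts Ch. 14 §0.1:
  "`Λ₁ ⊂ Λ` is called primitive if `Λ/Λ₁` is torsion free"), i.e. `Hᵏ(X, ℤ)/Hdg^{k,p}(X, ℤ)` is torsion free;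
* §2 hence a DIRECT SUMMAND of `Hᵏ(X, ℤ)` (Kaplansky §7 (e) + Theorem 5 for finitely generated groups, the tree's
  `Purity.exists_isCompl_of_nsmulSaturated_of_fg`): `Hᵏ(X, ℤ) = Hdg^{k,p}(X, ℤ) ⊕ K`, with `K` free of rank `C(|ι|, k) − rk Hdg^{k,p}(X, ℤ)`;
* §3 every `ℤ`-basis of `Hdg^{k,p}(X, ℤ)` EXTENDS to a `ℤ`-basis of `Hᵏ(X, ℤ)`.

Contrast: the ORTHOGONAL complement `T = Hdg^⊥` in the middle degree is a complement iff `Hdg` is unimodular (the tree's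
`isCompl_hodgeSublattice_orthogonal_iff`, `ComplexTorusMiddleHodgeLatticeSplitting`); the complements `K` here are not orthogonal in general.

## Contents (theorems only)

* §1 `mem_hodgeSublatticeIn_iff`, **`nsmulSaturated_integralHodgeClassesIn_addSubgroupOf`** (degree-free; the degree-`2p` `ℤ`-scalar form is
  the tree's `mem_hodgeSublattice_of_smul_mem`), **`isAddTorsionFree_quotient_integralHodgeClassesIn`**.
* §2 **`exists_isCompl_integralHodgeClassesIn_addSubgroupOf`** (`∃ K : AddSubgroup`, `IsCompl Hdg K`), **`exists_isCompl_hodgeSublatticeIn`**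
  (`∃ K : Submodule ℤ`), `exists_isCompl_hodgeSublattice` (middle degree, the tree's spelling), **`exists_isCompl_finrank_hodgeSublatticeIn`**
  (`rk K = C(|ι|, k) − rk Hdg^{k,p}(X, ℤ)`).
* §3 **`exists_basis_sum_extending_hodgeSublatticeIn`** (a basis of `Hᵏ(X, ℤ)` indexed by `κ ⊕ κ′` restricting to a given basis of `Hdg` on `κ`).

## References

* [cite: Huybrechts2016K3, Ch. 14 §0.1 (PDF p. 333: primitive sublattices, "`Λ/Λ₁` torsion free")]
* [cite: Kaplansky1954, §7 (e) and Theorem 5 (PDF pp. 17–18)] (through `Literature.GroupTheory.Abelian.PureSubgroupFreeQuotient`)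
* [cite: Lange2023AbelianVarietiesComplex, §7.2.2; §1.1.3 Exercise 1.1.6 (8); §1.3.1 Exercise 1.3.4 (10)(a)]
* [cite: VoisinHodgeI2002, §11.3.1 Def. 11.28 (PDF p. 231)]
-/

noncomputable section

open Module Function
open Literature.Analysis.Complex (typeSubmodule)
open Literature.GroupTheory.Abelian.Purity

universe u

namespace Literature.Geometry.Kaehler.ComplexTorus

section DirectSummand

variable {ι : Type*} {E : Type u} [NormedAddCommGroup E] [NormedSpace ℂ E] (Φ : (ι → ℝ) ≃L[ℝ] E)

/-! ## §1 `Hdg^{k,p}(X, ℤ) ⊂ Hᵏ(X, ℤ)` is saturated; the quotient is torsion free -/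

/-- Membership in the sublattice `Hdg^{k,p}(X, ℤ) ⊂ Hᵏ(X, ℤ)`. [cite: Lange2023AbelianVarietiesComplex, §7.2.2] -/
theorem mem_hodgeSublatticeIn_iff {k p : ℕ} {x : integralForms Φ k} :
    x ∈ AddSubgroup.toIntSubmodule ((integralHodgeClassesIn Φ k p).addSubgroupOf (integralForms Φ k)) ↔
      (x : E [⋀^Fin k]→L[ℝ] ℂ) ∈ integralHodgeClassesIn Φ k p :=
  AddSubgroup.mem_addSubgroupOf

/-- **`Hdg^{k,p}(X, ℤ)` is a saturated (primitive) subgroup of `Hᵏ(X, ℤ)`**: `n · x ∈ Hdg^{k,p}(X, ℤ)` forces `n = 0` or `x ∈ Hdg^{k,p}(X, ℤ)`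
(`Λ^{p,p}` is a `ℂ`-linear subspace). [cite: Huybrechts2016K3, Ch. 14 §0.1 (PDF p. 333)] [cite: Lange2023AbelianVarietiesComplex, §7.2.2] -/
theorem nsmulSaturated_integralHodgeClassesIn_addSubgroupOf (k p : ℕ) :
    ((integralHodgeClassesIn Φ k p).addSubgroupOf (integralForms Φ k)).toAddSubmonoid.NSMulSaturated := by
  intro n x hx
  rcases Nat.eq_zero_or_pos n with rfl | hn
  · exact Or.inl rfl
  refine Or.inr ?_
  have hx' : ((n • x : integralForms Φ k) : E [⋀^Fin k]→L[ℝ] ℂ) ∈ integralHodgeClassesIn Φ k p := hx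
  rw [AddSubmonoidClass.coe_nsmul, ← Nat.cast_smul_eq_nsmul ℂ] at hx'
  change (x : E [⋀^Fin k]→L[ℝ] ℂ) ∈ integralHodgeClassesIn Φ k p
  refine ⟨x.2, ?_⟩
  have h2 : (n : ℂ) • (x : E [⋀^Fin k]→L[ℝ] ℂ) ∈ typeSubmodule E k p p := hx'.2
  have h3 := Submodule.smul_mem _ (n : ℂ)⁻¹ h2
  rwa [smul_smul, inv_mul_cancel₀ (Nat.cast_ne_zero.2 hn.ne'), one_smul] at h3

/-- **`Hᵏ(X, ℤ)/Hdg^{k,p}(X, ℤ)` is torsion free** (Kaplansky §7 (e): saturated ⟺ torsion-free quotient).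
[cite: Huybrechts2016K3, Ch. 14 §0.1 (PDF p. 333)] [cite: Kaplansky1954, §7 (e) (PDF p. 17)] -/
theorem isAddTorsionFree_quotient_integralHodgeClassesIn (k p : ℕ) :
    IsAddTorsionFree (integralForms Φ k ⧸ (integralHodgeClassesIn Φ k p).addSubgroupOf (integralForms Φ k)) :=
  (nsmulSaturated_iff_isAddTorsionFree_quotient _).1 (nsmulSaturated_integralHodgeClassesIn_addSubgroupOf Φ k p)

/-! ## §2 `Hdg^{k,p}(X, ℤ)` is a direct summand of `Hᵏ(X, ℤ)` -/

variable [Fintype ι]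

/-- **`Hdg^{k,p}(X, ℤ)` is a direct summand of `Hᵏ(X, ℤ)`**: there is a subgroup `K` with `Hᵏ(X, ℤ) = Hdg^{k,p}(X, ℤ) ⊕ K` (a saturated
subgroup of a finitely generated abelian group is a direct summand — Kaplansky §7 (e) + Theorem 5, the tree's
`Purity.exists_isCompl_of_nsmulSaturated_of_fg`; `Hᵏ(X, ℤ)` is finitely generated, `finite_integralForms`).
[cite: Kaplansky1954, §7 (e) and Theorem 5 (PDF pp. 17–18)] [cite: Huybrechts2016K3, Ch. 14 §0.1 (PDF p. 333)] -/
theorem exists_isCompl_integralHodgeClassesIn_addSubgroupOf (k p : ℕ) :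
    ∃ K : AddSubgroup (integralForms Φ k), IsCompl ((integralHodgeClassesIn Φ k p).addSubgroupOf (integralForms Φ k)) K := by
  haveI : Module.Finite ℤ (integralForms Φ k) := finite_integralForms Φ k
  haveI : AddGroup.FG (integralForms Φ k) := Module.Finite.iff_addGroup_fg.1 inferInstance
  exact exists_isCompl_of_nsmulSaturated_of_fg (nsmulSaturated_integralHodgeClassesIn_addSubgroupOf Φ k p)

/-- **`Hᵏ(X, ℤ) = Hdg^{k,p}(X, ℤ) ⊕ K` with `K` a `ℤ`-submodule** (sublattice form of the previous theorem).
[cite: Kaplansky1954, §7 Theorem 5 (PDF pp. 17–18)] [cite: Huybrechts2016K3, Ch. 14 §0.1 (PDF p. 333)] -/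
theorem exists_isCompl_hodgeSublatticeIn (k p : ℕ) :
    ∃ K : Submodule ℤ (integralForms Φ k),
      IsCompl (AddSubgroup.toIntSubmodule ((integralHodgeClassesIn Φ k p).addSubgroupOf (integralForms Φ k))) K := by
  obtain ⟨K, hK⟩ := exists_isCompl_integralHodgeClassesIn_addSubgroupOf Φ k p
  exact ⟨AddSubgroup.toIntSubmodule K, AddSubgroup.toIntSubmodule.isCompl hK⟩

/-- **The middle-degree Hodge lattice `Hdg ⊂ H^{2p}(X, ℤ)` (rows g30-#4…#9) is a direct summand** — unconditionally, with SOME complement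
(the orthogonal complement `T = Hdg^⊥` is one iff `Hdg` is unimodular, the tree's `isCompl_hodgeSublattice_orthogonal_iff`).
[cite: Kaplansky1954, §7 Theorem 5 (PDF pp. 17–18)] [cite: Huybrechts2016K3, Ch. 14 §0.1 (PDF p. 333)] -/
theorem exists_isCompl_hodgeSublattice (p : ℕ) :
    ∃ K : Submodule ℤ (integralForms Φ (2 * p)),
      IsCompl (AddSubgroup.toIntSubmodule ((integralHodgeClasses Φ p).addSubgroupOf (integralForms Φ (2 * p)))) K :=
  exists_isCompl_hodgeSublatticeIn Φ (2 * p) p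

/-- **`Hᵏ(X, ℤ) = Hdg^{k,p}(X, ℤ) ⊕ K` with `K` free of rank `C(|ι|, k) − rk_ℤ Hdg^{k,p}(X, ℤ)`** (`|ι| = rk Λ = 2 dim X`;
`rk Hᵏ(X, ℤ) = C(|ι|, k)`, Exercise 1.1.6 (8)). [cite: Kaplansky1954, §7 Theorem 5 (PDF pp. 17–18)] [cite: Lange2023AbelianVarietiesComplex, §1.1.3 Exercise 1.1.6 (8) and §7.2.2] -/
theorem exists_isCompl_finrank_hodgeSublatticeIn (k p : ℕ) :
    ∃ K : Submodule ℤ (integralForms Φ k),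
      IsCompl (AddSubgroup.toIntSubmodule ((integralHodgeClassesIn Φ k p).addSubgroupOf (integralForms Φ k))) K ∧
        finrank ℤ K = (Fintype.card ι).choose k - finrank ℤ (integralHodgeClassesIn Φ k p) := by
  obtain ⟨K, hK⟩ := exists_isCompl_hodgeSublatticeIn Φ k p
  haveI : Module.Free ℤ (integralForms Φ k) := free_integralForms Φ k
  haveI : Module.Finite ℤ (integralForms Φ k) := finite_integralForms Φ k
  set H := AddSubgroup.toIntSubmodule ((integralHodgeClassesIn Φ k p).addSubgroupOf (integralForms Φ k)) with hHdef
  haveI : Module.IsTorsionFree ℤ H := Function.Injective.moduleIsTorsionFree H.subtype H.injective_subtype (map_smul H.subtype)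
  haveI : Module.IsTorsionFree ℤ K := Function.Injective.moduleIsTorsionFree K.subtype K.injective_subtype (map_smul K.subtype)
  have hsum : finrank ℤ H + finrank ℤ K = finrank ℤ (integralForms Φ k) := by
    rw [← (Submodule.prodEquivOfIsCompl H K hK).finrank_eq, Module.finrank_prod]
  have hH : finrank ℤ H = finrank ℤ (integralHodgeClassesIn Φ k p) := by
    let eS : integralHodgeClassesIn Φ k p ≃ₗ[ℤ] H :=
      { toFun := fun s ↦ ⟨⟨s, s.2.1⟩, (mem_hodgeSublatticeIn_iff Φ).2 s.2⟩
        invFun := fun y ↦ ⟨((y : H) : integralForms Φ k), (mem_hodgeSublatticeIn_iff Φ).1 y.2⟩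
        map_add' := fun _ _ ↦ rfl
        map_smul' := fun _ _ ↦ rfl
        left_inv := fun _ ↦ rfl
        right_inv := fun _ ↦ rfl }
    exact eS.symm.finrank_eq
  refine ⟨K, hK, ?_⟩
  rw [← hH, ← finrank_integralForms_eq_choose Φ k]
  change finrank ℤ K = finrank ℤ (integralForms Φ k) - finrank ℤ H
  omega

/-! ## §3 Every `ℤ`-basis of `Hdg^{k,p}(X, ℤ)` extends to a `ℤ`-basis of `Hᵏ(X, ℤ)` -/

/-- **A `ℤ`-basis of the primitive sublattice `Hdg^{k,p}(X, ℤ)` extends to a `ℤ`-basis of `Hᵏ(X, ℤ)`**: for every basis `(sᵢ)_{i ∈ κ}` of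
`Hdg^{k,p}(X, ℤ) ⊂ Hᵏ(X, ℤ)` there are an index type `κ′` and a basis of `Hᵏ(X, ℤ)` indexed by `κ ⊕ κ′` whose `κ`-part is `(sᵢ)`
(a basis of a complement `K` on `κ′`). [cite: Huybrechts2016K3, Ch. 14 §0.1 (PDF p. 333)] [cite: Kaplansky1954, §7 Theorem 5 (PDF pp. 17–18)] -/
theorem exists_basis_sum_extending_hodgeSublatticeIn (k p : ℕ) {κ : Type*}
    (bH : Basis κ ℤ (AddSubgroup.toIntSubmodule ((integralHodgeClassesIn Φ k p).addSubgroupOf (integralForms Φ k)))) :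
    ∃ (κ' : Type u) (b : Basis (κ ⊕ κ') ℤ (integralForms Φ k)),
      ∀ i, b (Sum.inl i) = ((bH i : AddSubgroup.toIntSubmodule ((integralHodgeClassesIn Φ k p).addSubgroupOf (integralForms Φ k))) :
        integralForms Φ k) := by
  obtain ⟨K, hK⟩ := exists_isCompl_hodgeSublatticeIn Φ k p
  haveI : Module.Free ℤ (integralForms Φ k) := free_integralForms Φ k
  haveI : Module.Finite ℤ (integralForms Φ k) := finite_integralForms Φ k
  haveI : Module.IsTorsionFree ℤ K := Function.Injective.moduleIsTorsionFree K.subtype K.injective_subtype (map_smul K.subtype)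
  let bK := Module.Free.chooseBasis ℤ K
  refine ⟨Module.Free.ChooseBasisIndex ℤ K, (bH.prod bK).map (Submodule.prodEquivOfIsCompl _ K hK), fun i ↦ ?_⟩
  rw [Basis.map_apply, Submodule.coe_prodEquivOfIsCompl', Basis.prod_apply_inl_fst, Basis.prod_apply_inl_snd,
    Submodule.coe_zero, add_zero]

end DirectSummand

end Literature.Geometry.Kaehler.ComplexTorus
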